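import Literature.NumberTheory.EllipticCurves.AnticyclotomicRankinSelbergPAdicLFunction
import Literature.NumberTheory.Automorphic.BCDTModularity
import HarnessLib

/-!
# Hsieh 2014, Theorem B (= Thm. 2 of the e-print = Thm. 6.2 in the body): the VANISHING OF THE
# ANTICYCLOTOMIC `μ`-INVARIANT `μ⁻_{π,λ,Σ} = 0` of the Rankin–Selberg `p`-adic `L`-function
# `𝒫_Σ(π, λ)` — at `𝓕 = ℚ`, weight `2`, `π = π_{f_E}`, in the frame `IsHsiehLFunction` of the tree

M.-L. Hsieh, *Special values of anticyclotomic Rankin–Selberg `L`-functions*, Doc. Math. **19**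
(2014) 709–767 (Thm. B p. 712) = arXiv:1112.1580 (Thm. 2, e-print pp. 3–4; Thm. 6.1/6.2 §6.2); held
text `paper:arxiv-1112.1580` (chunk locators `[pNNNN:Lnn]` below are e-print locators, as in the
companion file `AnticyclotomicRankinSelbergPAdicLFunction.lean` whose Thm. A/1 fact
`hsieh2014_exists_anticyclotomicPAdicLFunction` this file EXTENDS by one clause). Cell
`pub/bsd-littype` (cross-ladder literature-typing layer, D-0088(4)), seat `bsd-littype-04`: this is
THE `μ = 0` input of Yan–Zhu 2026 (J. Algebra 693), proof of Thm. 1.2 / 4.2 (arXiv:2412.20078v4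
l.1043–1047: "by [hsieh2014special, Theorem B] and Proposition 3.14, `μ(𝓛_p^Gr(E/K)⁻) =
μ(𝓛_p^BDP(E/K)) = 0`"), valid at EVERY odd prime `p` split in `K`, `p = 3` included — one of the
"inputs at `p = 3`" the typing layer was asked to vendor.

## The printed statement (e-print p. 4 = [p0004:L24–L38], verbatim)

"Our second theorem is to prove the vanishing of the Iwasawa `μ`-invariant `μ⁻_{π,λ,Σ}` of
`𝒫_Σ(π,λ)` under certain hypothesis. This in particular implies that the `L`-function `𝓛_Σ(π,λ)`
is non-trivial. Recall that the `μ`-invariant `μ⁻_{π,λ,Σ}` is defined by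
`μ⁻_{π,λ,Σ} = inf{r ∈ ℚ_{≥0} ∣ p^{−r}𝒫_Σ(π,λ) ≢ 0 (mod 𝔪_pΛ)}`, where `𝔪_p` is the maximal ideal of
`Z̄_p`. Let `𝔠_λ` be the conductor of `λ`. For each `v ∣ 𝔠_λ⁻`, let `Δ_{λ,v}` be the finite group
`λ(𝒪_{𝒦_v}^×)`. **Theorem 2.** With the assumptions in Theorem 1, suppose further that (1) `p` is
unramified in `𝓕`, (2) the residual Galois representation `ρ̄_p(π_𝒦) := ρ_p(π)|_{G_𝒦} (mod 𝔪_p)` is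
absolutely irreducible, (3) `p ∤ ∏_{v∣𝔠_λ⁻} #(Δ_{λ,v})`. Then `μ⁻_{π,λ,Σ} = 0`." And [p0004:L39]: "In
particular, suppose that `(𝔫, 𝒟_{𝒦/𝓕}) = 1` and `ρ_p(π)` is residually irreducible. Then we always
have `μ⁻_{π,λ} = 0` whenever `λ` has split conductor over `𝓕` (`𝔠_λ⁻ = (1)`)." Proof: §6.2, Thm. 6.1
[p0025:L21–L51] ("`μ⁻_{π,λ,Σ} = inf_{(a,u) ∈ 𝒟₁×𝒟₀, β ∈ 𝓕₊} v_p(𝐚_β(𝐟*_{λ,u}, 𝔠(a)))`", all forms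
"defined over `𝒪_L`" for "a sufficient large finite extension `L` over `ℚ_p`") and Thm. 6.2
[p0025:L53–L60] (Hida's linear independence of modular forms mod `p`).

## Transcription (the companion's binders VERBATIM, plus two; conclusion plus one clause)

The setting is that of `hsieh2014_exists_anticyclotomicPAdicLFunction` (module docstring of the
companion, (S1)–(S8), (W1)–(W4), (E1)–(E2)): `𝓕 = ℚ` (so hypothesis (1) is vacuous), `π = π_f` for a
weight-`2` newform `f` of level `Γ₀(N)`, `p` odd with `v_p(N) ≤ 1`, `K` imaginary quadratic with `p`
split (= (ord)) and the Heegner hypothesis for `N` (Hypothesis 1 and (sf) vacuous), `𝔭 ∋ p` induced by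
the embedding datum `ι`, `λ` unitary of infinity type `(1, −1)`, trivial on `𝔸_ℚ^×`, UNRAMIFIED
OUTSIDE `p` with a `p`-adic avatar through `Γ⁻` — so `𝔠_λ` is supported on the two SPLIT primes above
`p` and `𝔠_λ⁻ = (1)`: hypothesis (3) is VACUOUS ([p0004:L39] says exactly this). The two NEW binders:
`π = π_{f_E}` for an elliptic curve `E/ℚ` — `W : WeierstrassCurve ℚ`, `IsNewformOf W f` (SPECIAL CASE of
Hsieh's general `π`; then `ρ_p(π) ≅ V_pE` up to a twist/dual, which does not affect residual absolute
irreducibility) — and hypothesis (2) "`ρ̄_p(π)|_{G_K}` absolutely irreducible" = every framed mod-`p`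
representation `ρ : Γ_K → GL₂(𝔽_p)` of `E/K` (`(W.baseChange K).IsTorsionGaloisRep p ρ`, BCDT file) is
`FramedRep.IsAbsolutelyIrreducible` (irreducible after every extension of scalars; such framings exist
and are `GL₂(𝔽_p)`-conjugate, `WeierstrassCurve.exists_isTorsionGaloisRep`). CONCLUSION: the companion's
conclusion (a frame `(A, Ω_K, C, Ω_p, Q)` with `IsHsiehLFunction ι 𝔭 κ γ f A Ω_K C Ω_p Q`, `Q = [g]⁻¹ ·
Tw_{λ̂⁻¹}(𝒫_Σ(π,λ)²) ∈ 𝒪_{ℂ_p}⟦T⟧`, (W2)) AND `Q ≢ 0 (mod 𝔪_{ℂ_p})`, i.e. SOME COEFFICIENT OF `Q` IS A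
`p`-ADIC UNIT: `∃ n, ‖[Tⁿ]Q‖ = 1`. Why this is (implied by) `μ⁻_{π,λ,Σ} = 0`: by Thm. 6.1 the `μ`-invariant
is an infimum of valuations of Fourier coefficients lying in a FINITE extension `𝒪_L` ([p0025:L23–L24]),
hence attained, so `μ⁻ = 0` gives `𝒫_Σ(π,λ) ≢ 0 (mod 𝔪_pΛ)` (the `r = 0` instance of the definition);
`Λ/𝔪_pΛ = F̄_p⟦Γ⁻⟧` is a domain, so `𝒫² ≢ 0`; `Tw_{λ̂⁻¹}` (`γ ↦ λ̂(γ)⁻¹γ`, `λ̂(γ)` a principal unit) and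
multiplication by the group element `[g]⁻¹ ∈ Λ^×` preserve non-vanishing mod `𝔪_p`; and an element of
`𝒪_{ℂ_p}⟦T⟧` is non-zero mod `𝔪_{ℂ_p}` iff one of its coefficients has norm `1`. WEAKER than print
(special case `π = π_{f_E}`; consequence-shaped conclusion), never stronger.
`-- TODO(general form): Hsieh's Thm. B for a general cuspidal π of parallel weight κ over a totally`
`-- real 𝓕, CM type Σ, and λ with 𝔠_λ⁻ ≠ (1) under hypothesis (3); and the converse Thm. 6.2 (μ⁻ = 0`
`-- iff Σ_{v∣𝔠_λ⁻} μ_p(λ_v) = 0).`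

Status: REFEREED and published (Doc. Math. 19 (2014); ERRATUM E-G131-1 of the companion: in print
`C(π,λ) := 1`, Thm. B = p. 712). Nothing is asserted (D-0014): ONE named fact, no `_holds`.

## References

* [Hsieh2014] M.-L. Hsieh, Doc. Math. 19 (2014) 709–767, Thm. B (p. 712), Thm. 6.1–6.2; e-print
  arXiv:1112.1580: Thm. 2 [p0004:L31–L38], remark [p0004:L39], §6.2 [p0025:L17–L60].
* [YanZhu2024MainConjNonCM] X. Yan, X. Zhu, J. Algebra 693 (2026), proof of Thm. 4.2 (arXiv v4
  l.1043–1047) — the consumer ("by [Hsieh, Theorem B] … `μ(𝓛_p^BDP(E/K)) = 0`").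
* Tree: `AnticyclotomicRankinSelbergPAdicLFunction.lean` (`IsHsiehLFunction`, Thm. A fact),
  `Automorphic/BCDTModularity.lean` (`WeierstrassCurve.IsTorsionGaloisRep`),
  `GaloisRepresentations/ContinuousRep.lean` (`FramedRep.IsAbsolutelyIrreducible`).
-/

set_option autoImplicit false

noncomputable section

open scoped MatrixGroups ModularForm Topology NumberField
open CongruenceSubgroup NumberField IsDedekindDomain Field
open Literature.NumberTheory.GaloisRepresentations
open Literature.NumberTheory.EllipticCurves.ModularForms
open Literature.NumberTheory.Automorphic

namespace Literature.NumberTheory.EllipticCurves.Hsieh2014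

/-- **Hsieh, Doc. Math. 19 (2014), Theorem B (p. 712) = Thm. 2 of arXiv:1112.1580 [p0004:L31–L38] —
the anticyclotomic `μ`-invariant of `𝒫_Σ(π,λ)` VANISHES**, at `𝓕 = ℚ`, weight `2`, `π = π_{f_E}`,
in the tree's frame. Verbatim: "Theorem 2. With the assumptions in Theorem 1, suppose further that
(1) `p` is unramified in `𝓕`, (2) the residual Galois representation `ρ̄_p(π_𝒦) := ρ_p(π)|_{G_𝒦}
(mod 𝔪_p)` is absolutely irreducible, (3) `p ∤ ∏_{v∣𝔠_λ⁻} #(Δ_{λ,v})`. Then `μ⁻_{π,λ,Σ} = 0`", where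
"`μ⁻_{π,λ,Σ} = inf{r ∈ ℚ_{≥0} ∣ p^{−r}𝒫_Σ(π,λ) ≢ 0 (mod 𝔪_pΛ)}`" [p0004:L27]. Transcription
(module docstring): ALL binders of `hsieh2014_exists_anticyclotomicPAdicLFunction` verbatim (they
make (1) and (3) vacuous: `𝓕 = ℚ`; `λ` unramified outside the split prime `p`, so `𝔠_λ⁻ = (1)` —
[p0004:L39]), plus `π = π_{f_E}` (`W`, `IsNewformOf W f`; special case) and (2) as "every framed
mod-`p` representation of `E/K` is absolutely irreducible" (`IsTorsionGaloisRep`,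
`FramedRep.IsAbsolutelyIrreducible`); conclusion = the companion's frame `(A, Ω_K, C, Ω_p, Q)` with
`IsHsiehLFunction …` AND `∃ n, ‖[Tⁿ]Q‖ = 1` (`Q ≢ 0 (mod 𝔪)`, the consequence of `μ⁻ = 0` recorded
in the module docstring: Thm. 6.1 makes the infimum attained). WEAKER than print.
[cite: Hsieh2014, Thm. B (Doc. Math. 19 p. 712) = Thm. 2 (arXiv:1112.1580 p. 4 ll. 31–38), with p. 4 l. 39 and Thm. 6.1–6.2 (§6.2)]
[cite: YanZhu2024MainConjNonCM, proof of Thm. 4.2 (arXiv:2412.20078v4 l.1043–1047) (the consumer)] -/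
def thmB_exists_isHsiehLFunction_coeff_norm_eq_one : Prop :=
  ∀ {p : ℕ} [Fact p.Prime] (ι : PadicAlgCl p ≃+* ℂ) (K : Type) [Field K] [NumberField K]
    (𝔭 : HeightOneSpectrum (𝓞 K)) (κ : ZpExtension K p) (γ : absoluteGaloisGroup K)
    {N : ℕ} [NeZero N] (W : WeierstrassCurve ℚ) [W.IsElliptic] (f : CuspForm (Gamma0 N) 2)
    (lam : HeckeCharacter K) (rlam : FramedGaloisRep K (PadicAlgCl p) 1),
    p ≠ 2 → IsNewformOf W f → ¬ p ^ 2 ∣ N →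
    IsImaginaryQuadratic K → ((Ideal.span {(p : ℤ)}).primesOver (𝓞 K)).ncard = 2 →
    ((p : ℕ) : 𝓞 K) ∈ 𝔭.asIdeal →
    (∀ (w : InfinitePlace K) (k : 𝓞 K), k ∈ 𝔭.asIdeal ↔ ‖ι.symm (w.embedding (k : K))‖ < 1) →
    SatisfiesHeegnerHypothesis N K →
    (∀ ρ : ModPGaloisRep K (ZMod p) 2, (W.baseChange K).IsTorsionGaloisRep p ρ →
      FramedRep.IsAbsolutelyIrreducible ρ) →
    lam.IsUnitary → lam.HasInfinityType (fun _ ↦ (1 : ℤ)) (fun _ ↦ (-1 : ℤ)) →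
    (∀ x : ideleGroup ℚ, lam (AdeleRing.ideleBaseChange ℚ K x) = 1) →
    (∀ v : HeightOneSpectrum (𝓞 K), ((p : ℕ) : 𝓞 K) ∉ v.asIdeal → lam.IsUnramifiedAt v) →
    IsPAdicAvatarOf ι lam rlam → FactorsThroughZp κ rlam →
    κ.IsAnticyclotomic → κ.IsTopGenerator γ →
    ∃ (A : ℝ) (ΩK C : ℂ) (Ωp : ℂ_[p]) (Q : PowerSeries (PadicComplexInt p)),
      0 < A ∧ ΩK ≠ 0 ∧ ‖((ι.symm C : PadicAlgCl p) : ℂ_[p])‖ = 1 ∧ ‖Ωp‖ = 1 ∧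
        IsHsiehLFunction ι 𝔭 κ γ f A ΩK C Ωp Q ∧
        ∃ n : ℕ, ‖((PowerSeries.coeff n Q : PadicComplexInt p) : ℂ_[p])‖ = 1

/-- Theorem B's frame IS a Theorem A/1 frame: dropping the last clause recovers, for `π = π_{f_E}`
with `ρ̄_{E,p}|_{G_K}` absolutely irreducible, the conclusion of the companion fact
`hsieh2014_exists_anticyclotomicPAdicLFunction` (existence + interpolation), `IsNewformOf W f`
giving `IsNewform0 f`. [cite: Hsieh2014, Thm. A and Thm. B (Doc. Math. 19 p. 712)] -/
theorem exists_isHsiehLFunction_of_thmB (h : thmB_exists_isHsiehLFunction_coeff_norm_eq_one)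
    {p : ℕ} [Fact p.Prime] (ι : PadicAlgCl p ≃+* ℂ) (K : Type) [Field K] [NumberField K]
    (𝔭 : HeightOneSpectrum (𝓞 K)) (κ : ZpExtension K p) (γ : absoluteGaloisGroup K)
    {N : ℕ} [NeZero N] (W : WeierstrassCurve ℚ) [W.IsElliptic] (f : CuspForm (Gamma0 N) 2)
    (lam : HeckeCharacter K) (rlam : FramedGaloisRep K (PadicAlgCl p) 1)
    (hp : p ≠ 2) (hf : IsNewformOf W f) (hN : ¬ p ^ 2 ∣ N) (hK : IsImaginaryQuadratic K)
    (hsplit : ((Ideal.span {(p : ℤ)}).primesOver (𝓞 K)).ncard = 2)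
    (h𝔭 : ((p : ℕ) : 𝓞 K) ∈ 𝔭.asIdeal)
    (hι : ∀ (w : InfinitePlace K) (k : 𝓞 K), k ∈ 𝔭.asIdeal ↔ ‖ι.symm (w.embedding (k : K))‖ < 1)
    (hHeeg : SatisfiesHeegnerHypothesis N K)
    (habs : ∀ ρ : ModPGaloisRep K (ZMod p) 2, (W.baseChange K).IsTorsionGaloisRep p ρ →
      FramedRep.IsAbsolutelyIrreducible ρ)
    (hu : lam.IsUnitary) (hinf : lam.HasInfinityType (fun _ ↦ (1 : ℤ)) (fun _ ↦ (-1 : ℤ)))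
    (htriv : ∀ x : ideleGroup ℚ, lam (AdeleRing.ideleBaseChange ℚ K x) = 1)
    (hunr : ∀ v : HeightOneSpectrum (𝓞 K), ((p : ℕ) : 𝓞 K) ∉ v.asIdeal → lam.IsUnramifiedAt v)
    (hav : IsPAdicAvatarOf ι lam rlam) (hfac : FactorsThroughZp κ rlam)
    (hκ : κ.IsAnticyclotomic) (hγ : κ.IsTopGenerator γ) :
    ∃ (A : ℝ) (ΩK C : ℂ) (Ωp : ℂ_[p]) (Q : PowerSeries (PadicComplexInt p)),
      0 < A ∧ ΩK ≠ 0 ∧ ‖((ι.symm C : PadicAlgCl p) : ℂ_[p])‖ = 1 ∧ ‖Ωp‖ = 1 ∧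
        IsHsiehLFunction ι 𝔭 κ γ f A ΩK C Ωp Q := by
  obtain ⟨A, ΩK, C, Ωp, Q, hA, hΩK, hC, hΩp, hQ, -⟩ :=
    h ι K 𝔭 κ γ W f lam rlam hp hf hN hK hsplit h𝔭 hι hHeeg habs hu hinf htriv hunr hav hfac hκ hγ
  exact ⟨A, ΩK, C, Ωp, Q, hA, hΩK, hC, hΩp, hQ⟩

/-- The non-vanishing clause read as "`Q ≠ 0`": a power series with a coefficient of norm `1` is
not the zero series (Hsieh: "This in particular implies that the `L`-function `𝓛_Σ(π,λ)` is
non-trivial" [p0004:L24]). [cite: Hsieh2014, Thm. B and p. 712 (arXiv:1112.1580 p. 4 l. 24)] -/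
theorem ne_zero_of_coeff_norm_eq_one {p : ℕ} [Fact p.Prime] {Q : PowerSeries (PadicComplexInt p)}
    (h : ∃ n : ℕ, ‖((PowerSeries.coeff n Q : PadicComplexInt p) : ℂ_[p])‖ = 1) : Q ≠ 0 := by
  rintro rfl
  obtain ⟨n, hn⟩ := h
  simp at hn

end Literature.NumberTheory.EllipticCurves.Hsieh2014

end
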